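import Mathlib

/-!
# `HyperbolicEnd` (stmt-SmoothPoincare4-7825), line `Sketch`, negative side — conformal invariance of the certificate inequality

Helper for `Theorems/HyperbolicEnd/Negative/FrozenFill.lean` (frozen-J certificate filling fails
in complex dimension one). Statement registered on the crux item (stub helper_certificatePullback).

**The statement.** If `Φ` is smooth on an open `V ⊆ ℂ` with `2c Φ³ ≤ Φ ΔΦ - |∇Φ|²` on `V`, and
`g : U → V` is smooth on the open set `U` with `ℂ`-linear real derivative (i.e. holomorphic), then
the pulled-back density `λ(w) = Φ(g w) · ‖g'(w)‖²` (`g'(w) = Dg(w) 1`) is smooth on `U` and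
satisfies the same inequality `2c λ³ ≤ λ Δλ - |∇λ|²` there.  No sign assumption on `Φ` or `c`.

**The computation.** On `U` the real derivative `Dg(w) 1` is the complex derivative `deriv g w`
of the analytic function `g`.  Put `a = g'(z)`, `b = g''(z)`, `P = Φ(g z)`, `L = DΦ(g z)`,
`H = D²Φ(g z)`.  Along the real line `t ↦ z + t v` the slice of `λ` is
`Φ(g(z + t v)) · ‖g'(z + t v)‖²`; the one-variable chain and product rules (`slice`) give
`Dλ(z) v = L(a v) ‖a‖² + 2P ⟨a, b v⟩` and
`D²λ(z)[v, v] = (H(a v, a v) + L(b v²)) ‖a‖² + 4 L(a v) ⟨a, b v⟩ + 2P (⟨a, g‴ v²⟩ + ‖b v‖²)`.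
Summing over `v = 1, I`, the terms carrying `v² = ±1` cancel, `H(a, a) + H(a I, a I) = ‖a‖² ΔΦ`,
`L(a)² + L(a I)² = ‖a‖² |∇Φ|²` and `⟨a, b⟩² + ⟨a, b I⟩² = ‖a‖² ‖b‖²`, whence the exact identity
`λ Δλ - |∇λ|² = ‖a‖⁶ (Φ ΔΦ - |∇Φ|²)(g z)` (`algebra_step`); multiplying the hypothesis at
`g z ∈ V` by `‖a‖⁶ ≥ 0` gives the claim.
-/

noncomputable section

-- the prescribed namespace `Summit.<P>.<Sub>.…` duplicates `SmoothPoincare4` (P = Sub)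
set_option linter.dupNamespace false

open scoped ContDiff Topology Real RealInnerProductSpace
open Laplacian Set Filter Metric Complex

namespace Summit.SmoothPoincare4.SmoothPoincare4.Theorems.HyperbolicEnd.Negative

/-! ### One-variable reduction: derivatives along real lines -/

/-- **Line lemma.** For a real function `f` on `ℂ`, `C²` at `z`, the directional derivatives
`Df(z) v` and `D²f(z)[v, v]` are the first and second derivatives at `0` of the slice
`t ↦ f (z + t v)`, read off from one-variable `HasDerivAt` data
(copied from `Theorems/HyperbolicEnd/Negative/NeckDensity.lean`). -/
private theorem fderiv_iteratedFDeriv_of_line {f : ℂ → ℝ} {z v : ℂ} (hf : ContDiffAt ℝ 2 f z)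
    {m₁ : ℝ → ℝ} {m₂ : ℝ}
    (h₁ : ∀ᶠ t in 𝓝 (0 : ℝ), HasDerivAt (fun s : ℝ => f (z + s * v)) (m₁ t) t)
    (h₂ : HasDerivAt m₁ m₂ 0) :
    fderiv ℝ f z v = m₁ 0 ∧ iteratedFDeriv ℝ 2 f z ![v, v] = m₂ := by
  -- the line through `z` in direction `v`
  set γ : ℝ → ℂ := fun t => z + t * v with hγ_def
  have hγ : ∀ t, HasDerivAt γ v t := fun t => by
    have h := (((hasDerivAt_id (t : ℂ)).mul_const v).const_add z).comp_ofReal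
    simpa [hγ_def] using h
  have hγ0 : γ 0 = z := by simp [hγ_def]
  -- `f` is differentiable near `z`, `Df` is differentiable at `z`
  have hev : ∀ᶠ y in 𝓝 z, DifferentiableAt ℝ f y := by
    filter_upwards [hf.eventually (by simp)] with y hy
    exact hy.differentiableAt (by simp)
  have hD : DifferentiableAt ℝ (fderiv ℝ f) z :=
    (hf.fderiv_right (m := 1) (by norm_num)).differentiableAt one_ne_zero
  -- the slice and its first derivative near `0`
  have hφ' : ∀ᶠ t in 𝓝 (0 : ℝ), HasDerivAt (fun s : ℝ => f (z + s * v)) (fderiv ℝ f (γ t) v) t := by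
    have : ∀ᶠ t in 𝓝 (0 : ℝ), DifferentiableAt ℝ f (γ t) := by
      have hcont : ContinuousAt γ 0 := (hγ 0).continuousAt
      rw [← hγ0] at hev
      exact hcont.eventually hev
    filter_upwards [this] with t ht
    exact ht.hasFDerivAt.comp_hasDerivAt t (hγ t)
  -- so `m₁` agrees with `t ↦ Df(γ t) v` near `0`
  have hm₁ : m₁ =ᶠ[𝓝 0] fun t => fderiv ℝ f (γ t) v := by
    filter_upwards [h₁, hφ'] with t ht ht'
    exact ht.unique ht'
  refine ⟨?_, ?_⟩
  · have h0 := hm₁.eq_of_nhds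
    simp only [hγ0] at h0
    exact h0.symm
  · -- second derivative of the slice at `0`
    have h1 : HasDerivAt (fderiv ℝ f ∘ γ) (fderiv ℝ (fderiv ℝ f) (γ 0) v) 0 := by
      have hD' : DifferentiableAt ℝ (fderiv ℝ f) (γ 0) := by rw [hγ0]; exact hD
      exact hD'.hasFDerivAt.comp_hasDerivAt 0 (hγ 0)
    rw [hγ0] at h1
    have h2 := h1.clm_apply (hasDerivAt_const (0 : ℝ) v)
    simp only [ContinuousLinearMap.map_zero, add_zero, Function.comp_apply] at h2
    -- `h2 : HasDerivAt (fun t => fderiv ℝ f (γ t) v) (fderiv ℝ (fderiv ℝ f) z v v) 0`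
    have h3 : HasDerivAt m₁ (fderiv ℝ (fderiv ℝ f) z v v) 0 := h2.congr_of_eventuallyEq hm₁
    rw [iteratedFDeriv_two_apply]
    simpa using (h₂.unique h3).symm

/-! ### Holomorphic maps: complex differentiability, real derivative, slices -/

/-- A real-linear map `ℂ → ℂ` commuting with multiplication by `I` is multiplication by its value
at `1`. -/
private theorem clm_apply_eq_mul (L : ℂ →L[ℝ] ℂ) (hL : ∀ ζ : ℂ, L (I * ζ) = I * L ζ) (w : ℂ) :
    L w = w * L 1 := by
  have key : ∀ (r : ℝ) (ζ : ℂ), L ((r : ℂ) * ζ) = (r : ℂ) * L ζ := fun r ζ => by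
    rw [← Complex.real_smul, L.map_smul, Complex.real_smul]
  calc L w = L ((w.re : ℂ) * 1 + (w.im : ℂ) * (I * 1)) := by rw [mul_one, mul_one, re_add_im]
    _ = (w.re : ℂ) * L 1 + (w.im : ℂ) * (I * L 1) := by rw [map_add, key, key, hL]
    _ = w * L 1 := by
      conv_rhs => rw [← re_add_im w]
      ring

/-- A `C^∞` map `g` on an open `U ⊆ ℂ` whose real derivative is `ℂ`-linear is holomorphic. -/
private theorem differentiableOn_complex {g : ℂ → ℂ} {U : Set ℂ} (hU : IsOpen U)
    (hg : ContDiffOn ℝ ∞ g U)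
    (hhol : ∀ z ∈ U, ∀ ζ : ℂ, fderiv ℝ g z (I * ζ) = I * fderiv ℝ g z ζ) :
    DifferentiableOn ℂ g U := fun z hz => by
  have hd : DifferentiableAt ℝ g z :=
    ((hg z hz).contDiffAt (hU.mem_nhds hz)).differentiableAt (by simp)
  refine ((differentiableAt_iff_restrictScalars ℝ hd).2
    ⟨fderiv ℝ g z 1 • (1 : ℂ →L[ℂ] ℂ), ContinuousLinearMap.ext fun w => ?_⟩).differentiableWithinAt
  simp only [ContinuousLinearMap.coe_restrictScalars', smul_apply,
    one_apply_eq_self, smul_eq_mul]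
  rw [clm_apply_eq_mul (fderiv ℝ g z) (hhol z hz) w, mul_comm]

/-- For a holomorphic `h`, the real derivative is multiplication by `deriv h`. -/
private theorem fderiv_real_apply {h : ℂ → ℂ} {w : ℂ} (hh : DifferentiableAt ℂ h w) (v : ℂ) :
    fderiv ℝ h w v = deriv h w * v := by
  rw [hh.hasDerivAt.complexToReal_fderiv.fderiv, smul_apply,
    one_apply_eq_self, smul_eq_mul]

/-- Slice of a holomorphic `h` along the real line `s ↦ z + s v`, at a parameter `t` with
`z + t v ∈ U`. -/
private theorem hasDerivAt_hol_line {h : ℂ → ℂ} {U : Set ℂ} (hh : DifferentiableOn ℂ h U)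
    (hU : IsOpen U) (z v : ℂ) {t : ℝ} (ht : z + t * v ∈ U) :
    HasDerivAt (fun s : ℝ => h (z + s * v)) (deriv h (z + t * v) * v) t := by
  have h1 : HasDerivAt h (deriv h (z + t * v)) (z + t * v) :=
    (hh.differentiableAt (hU.mem_nhds ht)).hasDerivAt
  have h2 : HasDerivAt (fun ζ : ℂ => z + ζ * v) v (t : ℂ) := by
    simpa using ((hasDerivAt_id (t : ℂ)).mul_const v).const_add z
  exact (h1.comp (t : ℂ) h2).comp_ofReal

/-! ### The slice computation for the pulled-back density -/

/-- **Slice computation.** For `g` holomorphic on the open set `U ∋ z` and `Φ` of class `C²` at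
`g z`, the first two derivatives at `z` in the direction `v` of `(Φ ∘ g) · ‖deriv g‖²`, in terms
of `a = g'(z)`, `b = g''(z)`, `g‴(z)`, `P = Φ(g z)`, `L = DΦ(g z)`, `H = D²Φ(g z)`:
`L(a v) ‖a‖² + 2P⟨a, b v⟩` and
`(H(a v, a v) + L(b v v)) ‖a‖² + 2 · 2L(a v)⟨a, b v⟩ + 2P(⟨a, g‴ v v⟩ + ⟨b v, b v⟩)`. -/
private theorem slice {Φ : ℂ → ℝ} {g : ℂ → ℂ} {U : Set ℂ} {z : ℂ} (hU : IsOpen U) (hz : z ∈ U)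
    (hg : DifferentiableOn ℂ g U) (hΦ : ContDiffAt ℝ 2 Φ (g z)) (v : ℂ) :
    fderiv ℝ (fun w => Φ (g w) * ‖deriv g w‖ ^ 2) z v =
        fderiv ℝ Φ (g z) (deriv g z * v) * ‖deriv g z‖ ^ 2 +
          Φ (g z) * (2 * ⟪deriv g z, deriv (deriv g) z * v⟫) ∧
      iteratedFDeriv ℝ 2 (fun w => Φ (g w) * ‖deriv g w‖ ^ 2) z ![v, v] =
        (fderiv ℝ (fderiv ℝ Φ) (g z) (deriv g z * v) (deriv g z * v) +
                fderiv ℝ Φ (g z) (deriv (deriv g) z * v * v)) * ‖deriv g z‖ ^ 2 +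
            fderiv ℝ Φ (g z) (deriv g z * v) * (2 * ⟪deriv g z, deriv (deriv g) z * v⟫) +
          (fderiv ℝ Φ (g z) (deriv g z * v) * (2 * ⟪deriv g z, deriv (deriv g) z * v⟫) +
            Φ (g z) * (2 * (⟪deriv g z, deriv (deriv (deriv g)) z * v * v⟫ +
              ⟪deriv (deriv g) z * v, deriv (deriv g) z * v⟫))) := by
  have hg₁ : DifferentiableOn ℂ (deriv g) U := hg.deriv hU
  have hg₂ : DifferentiableOn ℂ (deriv (deriv g)) U := hg₁.deriv hU
  have hγ0 : z + ((0 : ℝ) : ℂ) * v = z := by simp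
  have h0U : z + ((0 : ℝ) : ℂ) * v ∈ U := by rw [hγ0]; exact hz
  -- the density is `C²` at `z`
  have hgz : ContDiffAt ℝ 2 g z := (hg.analyticAt (hU.mem_nhds hz)).contDiffAt.restrict_scalars ℝ
  have hdz : ContDiffAt ℝ 2 (deriv g) z :=
    (hg₁.analyticAt (hU.mem_nhds hz)).contDiffAt.restrict_scalars ℝ
  have hf : ContDiffAt ℝ 2 (fun w => Φ (g w) * ‖deriv g w‖ ^ 2) z :=
    (hΦ.comp z hgz).mul (hdz.norm_sq ℝ)
  -- the line stays in `U` near `t = 0`, and `Φ` is differentiable at its image points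
  have hc : Continuous fun t : ℝ => z + (t : ℂ) * v := by fun_prop
  have hU' : ∀ᶠ t : ℝ in 𝓝 0, z + (t : ℂ) * v ∈ U :=
    hc.continuousAt.preimage_mem_nhds (by simpa using hU.mem_nhds hz)
  have hΦ' : ∀ᶠ t : ℝ in 𝓝 0, DifferentiableAt ℝ Φ (g (z + (t : ℂ) * v)) := by
    have h1 : Tendsto (fun t : ℝ => g (z + (t : ℂ) * v)) (𝓝 0) (𝓝 (g z)) := by
      have h2 : Tendsto (fun t : ℝ => z + (t : ℂ) * v) (𝓝 0) (𝓝 z) := by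
        simpa using hc.tendsto 0
      exact (hg.differentiableAt (hU.mem_nhds hz)).continuousAt.tendsto.comp h2
    exact (h1.eventually (hΦ.eventually (by simp))).mono
      fun t ht => ht.differentiableAt two_ne_zero
  -- first derivative of the slice near `0`
  have h₁ : ∀ᶠ t : ℝ in 𝓝 0,
      HasDerivAt (fun s : ℝ => Φ (g (z + s * v)) * ‖deriv g (z + s * v)‖ ^ 2)
        (fderiv ℝ Φ (g (z + t * v)) (deriv g (z + t * v) * v) * ‖deriv g (z + t * v)‖ ^ 2 +
          Φ (g (z + t * v)) *
            (2 * ⟪deriv g (z + t * v), deriv (deriv g) (z + t * v) * v⟫)) t := by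
    filter_upwards [hU', hΦ'] with t ht hΦt
    have hA : HasDerivAt (fun s : ℝ => Φ (g (z + s * v)))
        (fderiv ℝ Φ (g (z + t * v)) (deriv g (z + t * v) * v)) t :=
      hΦt.hasFDerivAt.comp_hasDerivAt t (hasDerivAt_hol_line hg hU z v ht)
    exact hA.fun_mul (hasDerivAt_hol_line hg₁ hU z v ht).norm_sq
  -- derivatives at `0` of the four factors
  have hg0 : HasDerivAt (fun s : ℝ => g (z + s * v)) (deriv g z * v) 0 := by
    have h := hasDerivAt_hol_line hg hU z v h0U
    rwa [hγ0] at h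
  have hg10 : HasDerivAt (fun s : ℝ => deriv g (z + s * v)) (deriv (deriv g) z * v) 0 := by
    have h := hasDerivAt_hol_line hg₁ hU z v h0U
    rwa [hγ0] at h
  have hg20 : HasDerivAt (fun s : ℝ => deriv (deriv g) (z + s * v))
      (deriv (deriv (deriv g)) z * v) 0 := by
    have h := hasDerivAt_hol_line hg₂ hU z v h0U
    rwa [hγ0] at h
  have hL : HasDerivAt (fun s : ℝ => fderiv ℝ Φ (g (z + s * v)))
      (fderiv ℝ (fderiv ℝ Φ) (g z) (deriv g z * v)) 0 := by
    have hD : HasFDerivAt (fderiv ℝ Φ) (fderiv ℝ (fderiv ℝ Φ) (g z))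
        (g (z + ((0 : ℝ) : ℂ) * v)) := by
      rw [hγ0]
      exact ((hΦ.fderiv_right (m := 1) (by norm_num)).differentiableAt one_ne_zero).hasFDerivAt
    exact hD.comp_hasDerivAt (0 : ℝ) hg0
  have hP : HasDerivAt (fun s : ℝ => Φ (g (z + s * v))) (fderiv ℝ Φ (g z) (deriv g z * v)) 0 := by
    have hD : HasFDerivAt Φ (fderiv ℝ Φ (g z)) (g (z + ((0 : ℝ) : ℂ) * v)) := by
      rw [hγ0]
      exact (hΦ.differentiableAt two_ne_zero).hasFDerivAt
    exact hD.comp_hasDerivAt (0 : ℝ) hg0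
  -- second derivative of the slice at `0`
  have h₂ := ((hL.clm_apply (hg10.mul_const v)).fun_mul hg10.norm_sq).fun_add
    (hP.fun_mul ((hg10.inner ℝ (hg20.mul_const v)).const_mul (2 : ℝ)))
  rw [hγ0] at h₂
  obtain ⟨e1, e2⟩ := fderiv_iteratedFDeriv_of_line hf h₁ h₂
  refine ⟨?_, e2⟩
  rw [e1, hγ0]

/-! ### Pointwise linear algebra at `g z` -/

/-- A real-linear map out of `ℂ` in the coordinates `1, I`. -/
private theorem clm_re_im {F' : Type*} [NormedAddCommGroup F'] [NormedSpace ℝ F']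
    (L : ℂ →L[ℝ] F') (w : ℂ) : L w = w.re • L 1 + w.im • L I := by
  have hw : w = w.re • (1 : ℂ) + w.im • I := Complex.ext (by simp) (by simp)
  conv_lhs => rw [hw]
  rw [map_add, L.map_smul, L.map_smul]

/-- `|∇Φ|²` scales by `‖a‖²`: `L(a)² + L(a I)² = ‖a‖² (L(1)² + L(I)²)`. -/
private theorem clm_sq_add_sq (L : ℂ →L[ℝ] ℝ) (a : ℂ) :
    L (a * 1) ^ 2 + L (a * I) ^ 2 = ‖a‖ ^ 2 * (L 1 ^ 2 + L I ^ 2) := by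
  rw [clm_re_im L (a * 1), clm_re_im L (a * I), Complex.sq_norm, Complex.normSq_apply]
  simp only [smul_eq_mul, mul_one, mul_re, mul_im, I_re, I_im, mul_zero, zero_sub,
    add_zero]
  ring

/-- The `DΦ(g'' v v)` terms cancel between the directions `1` and `I`. -/
private theorem clm_cancel (L : ℂ →L[ℝ] ℝ) (b : ℂ) : L (b * 1 * 1) + L (b * I * I) = 0 := by
  rw [← L.map_add, mul_one, mul_one, mul_assoc, I_mul_I, mul_neg_one, add_neg_cancel, map_zero]

/-- `H(a, a) + H(a I, a I) = ‖a‖² (H(1, 1) + H(I, I))` for a real-bilinear form `H` on `ℂ`. -/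
private theorem bilin_sum (H : ℂ →L[ℝ] ℂ →L[ℝ] ℝ) (a : ℂ) :
    H (a * 1) (a * 1) + H (a * I) (a * I) = ‖a‖ ^ 2 * (H 1 1 + H I I) := by
  have h1 : ∀ w w' : ℂ, H w w' =
      w.re * (w'.re * H 1 1 + w'.im * H 1 I) + w.im * (w'.re * H I 1 + w'.im * H I I) := by
    intro w w'
    rw [clm_re_im H w, add_apply, smul_apply,
      smul_apply, clm_re_im (H 1) w', clm_re_im (H I) w']
    simp only [smul_eq_mul]
  rw [h1 (a * 1), h1 (a * I), Complex.sq_norm, Complex.normSq_apply]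
  simp only [mul_one, mul_re, mul_im, I_re, I_im, mul_zero, zero_sub, add_zero]
  ring

/-- Inner products on `ℂ = ℝ²`: `⟨a, b⟩² + ⟨a, b I⟩² = ‖a‖² ‖b‖²`, `⟨b v, b v⟩ = ‖b‖²` for
`v = 1, I`, and the `⟨a, g‴ v v⟩` terms cancel between the two directions. -/
private theorem inner_facts (a b e : ℂ) :
    ⟪a, b * 1⟫ ^ 2 + ⟪a, b * I⟫ ^ 2 = ‖a‖ ^ 2 * ‖b‖ ^ 2 ∧ ⟪b * 1, b * 1⟫ = ‖b‖ ^ 2 ∧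
      ⟪b * I, b * I⟫ = ‖b‖ ^ 2 ∧ ⟪a, e * 1 * 1⟫ + ⟪a, e * I * I⟫ = 0 := by
  refine ⟨?_, ?_, ?_, ?_⟩
  · simp only [Complex.inner, mul_one, mul_re, mul_im, conj_re, conj_im, I_re, I_im, mul_zero,
      zero_sub, add_zero, Complex.sq_norm, Complex.normSq_apply]
    ring
  · rw [mul_one, real_inner_self_eq_norm_sq]
  · rw [real_inner_self_eq_norm_sq, norm_mul, Complex.norm_I, mul_one]
  · rw [← inner_add_right, mul_one, mul_one, mul_assoc, I_mul_I, mul_neg_one, add_neg_cancel,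
      inner_zero_right]

/-- **The algebra.** With `N = ‖a‖² ≥ 0`, the slice formulas for `v = 1, I` and the identities
above give `λ Δλ - |∇λ|² = N³ (P ΔΦ - |∇Φ|²)`, so the hypothesis `2c P³ ≤ P ΔΦ - |∇Φ|²`
multiplied by `N³` is the claim `2c (P N)³ ≤ λ Δλ - |∇λ|²`. -/
private theorem algebra_step {c P N p q h11 hII X₁ X₂ β₁ β₂ H₁ H₂ M₁ M₂ B₁ B₂ E₁ E₂ nb : ℝ}
    (hN : 0 ≤ N) (h : 2 * c * P ^ 3 ≤ P * (h11 + hII) - (p ^ 2 + q ^ 2))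
    (i : X₁ ^ 2 + X₂ ^ 2 = N * (p ^ 2 + q ^ 2)) (ii : M₁ + M₂ = 0)
    (iii : H₁ + H₂ = N * (h11 + hII)) (iv : β₁ ^ 2 + β₂ ^ 2 = N * nb) (v₁ : B₁ = nb)
    (v₂ : B₂ = nb) (vi : E₁ + E₂ = 0) :
    2 * c * (P * N) ^ 3 ≤
      P * N * ((H₁ + M₁) * N + X₁ * (2 * β₁) + (X₁ * (2 * β₁) + P * (2 * (E₁ + B₁))) +
          ((H₂ + M₂) * N + X₂ * (2 * β₂) + (X₂ * (2 * β₂) + P * (2 * (E₂ + B₂))))) -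
        ((X₁ * N + P * (2 * β₁)) ^ 2 + (X₂ * N + P * (2 * β₂)) ^ 2) := by
  have key : N ^ 3 * (2 * c * P ^ 3) ≤ N ^ 3 * (P * (h11 + hII) - (p ^ 2 + q ^ 2)) :=
    mul_le_mul_of_nonneg_left h (pow_nonneg hN 3)
  calc 2 * c * (P * N) ^ 3 = N ^ 3 * (2 * c * P ^ 3) := by ring
    _ ≤ N ^ 3 * (P * (h11 + hII) - (p ^ 2 + q ^ 2)) := key
    _ = _ := by
      linear_combination (-(P * N ^ 2)) * iii - (P * N ^ 2) * ii - (2 * P ^ 2 * N) * v₁ -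
        (2 * P ^ 2 * N) * v₂ - (2 * P ^ 2 * N) * vi + N ^ 2 * i + 4 * P ^ 2 * iv

/-! ### The helper -/

/-- helper (W-C): **conformal invariance of the certificate inequality.**  If `Φ` is smooth on
the open set `V` with `2c Φ³ ≤ Φ ΔΦ - |∇Φ|²` there, and `g` is smooth on the open set `U` with
`ℂ`-linear real derivative and `g(U) ⊆ V`, then `λ(w) = Φ(g w) ‖Dg(w) 1‖²` is smooth on `U` and
`2c λ³ ≤ λ Δλ - |∇λ|²` on `U`. -/
theorem helper_certificatePullback : ∀ (Φ : ℂ → ℝ) (V U : Set ℂ) (g : ℂ → ℂ) (c : ℝ),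
    IsOpen V → IsOpen U → ContDiffOn ℝ ∞ Φ V →
    (∀ x ∈ V, 2 * c * (Φ x) ^ 3 ≤
      Φ x * (Δ Φ) x - ((fderiv ℝ Φ x 1) ^ 2 + (fderiv ℝ Φ x Complex.I) ^ 2)) →
    ContDiffOn ℝ ∞ g U →
    (∀ z ∈ U, ∀ ζ : ℂ, fderiv ℝ g z (Complex.I * ζ) = Complex.I * fderiv ℝ g z ζ) →
    (∀ z ∈ U, g z ∈ V) →
    ContDiffOn ℝ ∞ (fun w => Φ (g w) * ‖fderiv ℝ g w 1‖ ^ 2) U ∧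
      ∀ z ∈ U, 2 * c * (Φ (g z) * ‖fderiv ℝ g z 1‖ ^ 2) ^ 3 ≤
        Φ (g z) * ‖fderiv ℝ g z 1‖ ^ 2 * (Δ (fun w => Φ (g w) * ‖fderiv ℝ g w 1‖ ^ 2)) z -
          ((fderiv ℝ (fun w => Φ (g w) * ‖fderiv ℝ g w 1‖ ^ 2) z 1) ^ 2 +
            (fderiv ℝ (fun w => Φ (g w) * ‖fderiv ℝ g w 1‖ ^ 2) z Complex.I) ^ 2) := by
  intro Φ V U g c hV hU hΦ hineq hg hhol hmaps
  have hgC : DifferentiableOn ℂ g U := differentiableOn_complex hU hg hhol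
  -- on `U` the real derivative `Dg(w) 1` is the complex derivative
  have hd1 : ∀ w ∈ U, fderiv ℝ g w 1 = deriv g w := fun w hw => by
    rw [fderiv_real_apply (hgC.differentiableAt (hU.mem_nhds hw)), mul_one]
  have heq : ∀ w ∈ U, Φ (g w) * ‖fderiv ℝ g w 1‖ ^ 2 = Φ (g w) * ‖deriv g w‖ ^ 2 :=
    fun w hw => by rw [hd1 w hw]
  refine ⟨?_, fun z hz => ?_⟩
  · -- smoothness
    have h1 : ContDiffOn ℝ ∞ (fun w => Φ (g w)) U := hΦ.comp hg hmaps
    have h2 : ContDiffOn ℝ ∞ (fun w => ‖deriv g w‖ ^ 2) U :=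
      (((hgC.deriv hU).contDiffOn hU).restrict_scalars ℝ).norm_sq ℝ
    exact (h1.mul h2).congr heq
  · -- the inequality at `z ∈ U`
    have hgzV : g z ∈ V := hmaps z hz
    have hΦz : ContDiffAt ℝ 2 Φ (g z) :=
      ((hΦ (g z) hgzV).contDiffAt (hV.mem_nhds hgzV)).of_le (WithTop.coe_le_coe.2 le_top)
    have hev : (fun w => Φ (g w) * ‖fderiv ℝ g w 1‖ ^ 2) =ᶠ[𝓝 z]
        fun w => Φ (g w) * ‖deriv g w‖ ^ 2 :=
      Filter.eventually_of_mem (hU.mem_nhds hz) heq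
    have hΔ : (Δ Φ) (g z) =
        fderiv ℝ (fderiv ℝ Φ) (g z) 1 1 + fderiv ℝ (fderiv ℝ Φ) (g z) I I := by
      rw [InnerProductSpace.laplacian_eq_iteratedFDeriv_complexPlane Φ]
      simp [iteratedFDeriv_two_apply]
    have key := hineq (g z) hgzV
    rw [hΔ] at key
    obtain ⟨e1, e2⟩ := slice hU hz hgC hΦz 1
    obtain ⟨f1, f2⟩ := slice hU hz hgC hΦz I
    obtain ⟨i1, i2, i3, i4⟩ :=
      inner_facts (deriv g z) (deriv (deriv g) z) (deriv (deriv (deriv g)) z)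
    rw [hev.fderiv_eq, (InnerProductSpace.laplacian_congr_nhds hev).eq_of_nhds, hd1 z hz,
      InnerProductSpace.laplacian_eq_iteratedFDeriv_complexPlane]
    beta_reduce
    rw [e1, e2, f1, f2]
    exact algebra_step (sq_nonneg ‖deriv g z‖) key (clm_sq_add_sq (fderiv ℝ Φ (g z)) (deriv g z))
      (clm_cancel (fderiv ℝ Φ (g z)) (deriv (deriv g) z))
      (bilin_sum (fderiv ℝ (fderiv ℝ Φ) (g z)) (deriv g z)) i1 i2 i3 i4

end Summit.SmoothPoincare4.SmoothPoincare4.Theorems.HyperbolicEnd.Negative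

end
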